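import Summits.ResolutionOfSingularities.ResolutionOfSingularities.Theorems.PurelyInseparableDim4AtlasCertTwoComputations
import Summits.ResolutionOfSingularities.ResolutionOfSingularities.Theorems.PurelyInseparableDim4AtlasMemberDefs
import HarnessLib

/-!
# Purely inseparable four-folds: CHARTS of the DEPTH-TWO escaping certificate of the v4 atlas chain (brick S3 (c) v4, tranche 1,
# brick A6b-charts; cell `res-dim4-pi`)

[OURS · counted 0] (D-0157 DOOR 2; host item stmt-ResolutionOfSingularities-16155, helper). Nothing here proves resolution of
singularities in dimension ≥ 4 / characteristic `p`. For `F = x₁^{3p} x₄ + x₁^{p−1} x₂ x₃^{2p} + x₁ x₂^p x₃^{p−1} + x₂^{2p+1}`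
(`p ≥ 3`; A6b-computations): §1 the root charts — the entry point is equimultiple, the normalised equimultiple pairs of charts `x₁`/`x₂`
lie on the child (`b₃ = 0`), the child's reading states are `F₀`/`F₁`; §2 the child's charts — the same one storey down: the grandchild's
entry point is equimultiple, the normalised (owned) equimultiple pairs of charts `y₁`/`y₃` of the child's blow-up lie on the grandchild
(`b₂ = 0`), the grandchild's reading states are `F₀₀`/`F₀₂`, and the child's blow-up read on the extra reading `F₁` is DEAD (charts
`y₂`, `y₃`); §3 the grandchild's blow-up is DEAD on all four charts (`F₀₀₀`, `F₀₀₁`, `F₀₂₁`, `F₀₂₂`). Witnesses: first partial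
derivatives or one coefficient of degree `< p` of the translated chart transform.

AI-produced formalisation, weaker than expert review. bears_on: LADDER-RESOLUTION:D157-DOOR2 (res-dim4-pi · S3 (c) v4 A6b charts).
-/

set_option linter.dupNamespace false -- D-0017: single-problem summit path `Summit.<S>.<S>.…` by design

noncomputable section

open MvPolynomial Finset

namespace Summit.ResolutionOfSingularities.ResolutionOfSingularities.Theorems.PIDim4

open Literature.AlgebraicGeometry.Resolution
open Literature.AlgebraicGeometry.Resolution.Hauser2010

namespace Equimultiple

section BCertCharts

variable {K : Type} [Field K] {p : ℕ} [hp : Fact p.Prime] [CharP K p]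

/-! ## §1 The root charts -/

omit [CharP K p] in
/-- **The child's entry point is equimultiple**: every monomial of `F₀` has degree `≥ p`. [cite: Hauser2010, §F (equiconstant points)] -/
theorem isEquimultiplePoint_S0_zero_bcert [DecidableEq K] (s : State K)
    (hs : s.F = X 0 ^ (3 * p) * X 3 + X 0 ^ (p - 1) * X 1 * X 2 ^ (2 * p) + X 0 * X 1 ^ p * X 2 ^ (p - 1) + X 1 ^ (2 * p + 1)) :
    CentreBlowup.IsEquimultiplePoint p ({0, 1} : Finset (Fin 4)) 0 (0 : Fin 4 → K) s := by
  have hp1 : 1 ≤ p := hp.out.one_lt.le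
  intro d hd0 hdeg
  unfold CentreBlowup.pointTransform
  rw [hs, chartTransform_S0_bcert, PointBlowup.translate_zero]
  by_contra hne
  rcases mem_support_four (mem_support_iff.mpr hne) with rfl | rfl | rfl | rfl <;>
    rw [Rescue.BedSlopeResidual.degree_E4] at hdeg <;> omega

omit [CharP K p] in
/-- **Chart `x₁`: the normalised equimultiple pairs lie on the child** (`b₁ = 0 ⇒ b₃ = 0`; `∂₂ F₀ (b) = b₃^{2p}`).
[cite: Hauser2010, §F (equiconstant points)] -/
theorem eq_zero_of_isEquimultiplePoint_S0_bcert [DecidableEq K] {b : Fin 4 → K} (s : State K)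
    (hs : s.F = X 0 ^ (3 * p) * X 3 + X 0 ^ (p - 1) * X 1 * X 2 ^ (2 * p) + X 0 * X 1 ^ p * X 2 ^ (p - 1) + X 1 ^ (2 * p + 1))
    (h : CentreBlowup.IsEquimultiplePoint p ({0, 1} : Finset (Fin 4)) 0 b s) (hb : b 0 = 0) : b 2 = 0 := by
  have hp0 : p ≠ 0 := hp.out.ne_zero
  unfold CentreBlowup.IsEquimultiplePoint CentreBlowup.pointTransform at h
  rw [hs, chartTransform_S0_bcert] at h
  have h1 := eval_pderiv_eq_zero_of_forall_coeff b _ h 1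
  simp [(pderiv (1 : Fin 4)).leibniz_pow, hb, hp0] at h1
  exact h1

omit [CharP K p] in
/-- **Chart `x₂`: the normalised OWNED equimultiple pairs lie on the child** (`b₁ = b₂ = 0 ⇒ b₃ = 0`; the coefficient of `y₁^{p−1}`
is `b₃^{2p}`). [cite: Hauser2010, §F (equiconstant points)] -/
theorem eq_zero_of_isEquimultiplePoint_S1_bcert [DecidableEq K] (hp3 : 3 ≤ p) {b : Fin 4 → K} (s : State K)
    (hs : s.F = X 0 ^ (3 * p) * X 3 + X 0 ^ (p - 1) * X 1 * X 2 ^ (2 * p) + X 0 * X 1 ^ p * X 2 ^ (p - 1) + X 1 ^ (2 * p + 1))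
    (h : CentreBlowup.IsEquimultiplePoint p ({0, 1} : Finset (Fin 4)) 1 b s) (hb0 : b 0 = 0) (hb1 : b 1 = 0) : b 2 = 0 := by
  have hp0 : p ≠ 0 := hp.out.ne_zero
  unfold CentreBlowup.IsEquimultiplePoint CentreBlowup.pointTransform at h
  rw [hs, chartTransform_S1_bcert] at h
  have hc := h (Finsupp.single 0 (p - 1) + Finsupp.single 1 0 + Finsupp.single 2 0 + Finsupp.single 3 0)
    (fun he => by have := DFunLike.congr_fun he 0; simp at this; omega) (by rw [Rescue.BedSlopeResidual.degree_E4]; omega)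
  rw [Rescue.BedMohRiseQ4TopLocus.translate_add, Rescue.BedMohRiseQ4TopLocus.translate_add, Rescue.BedMohRiseQ4TopLocus.translate_add,
    coeff_add, coeff_add, coeff_add, coeff_translate_four, coeff_translate_four, coeff_translate_four, coeff_translate_four, hb0, hb1,
    Nat.choose_eq_zero_of_lt (show 1 < p - 1 by omega), Nat.choose_eq_zero_of_lt (show 0 < p - 1 by omega)] at hc
  simp [zero_pow (show 3 * p - (p - 1) ≠ 0 by omega)] at hc
  exact hc.1

omit [CharP K p] in
/-- **The child's main reading state is `F₀`.** [cite: HauserPerlega2019PRIMS, §2 (cleaning)] -/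
theorem step_S0_bcert [DecidableEq K] (s : State K)
    (hs : s.F = X 0 ^ (3 * p) * X 3 + X 0 ^ (p - 1) * X 1 * X 2 ^ (2 * p) + X 0 * X 1 ^ p * X 2 ^ (p - 1) + X 1 ^ (2 * p + 1)) :
    (CentreBlowup.step p ({0, 1} : Finset (Fin 4)) 0 (0 : Fin 4 → K) s).F =
      C 1 * (X 0 ^ (2 * p) * X 1 ^ 0 * X 2 ^ 0 * X 3 ^ 1) +
        C 1 * (X 0 ^ 0 * X 1 ^ 1 * X 2 ^ (2 * p) * X 3 ^ 0) +
        C 1 * (X 0 ^ 1 * X 1 ^ p * X 2 ^ (p - 1) * X 3 ^ 0) +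
        C 1 * (X 0 ^ (p + 1) * X 1 ^ (2 * p + 1) * X 2 ^ 0 * X 3 ^ 0) := by
  show deletePthPowers p (PointBlowup.translate (0 : Fin 4 → K)
    (CentreBlowup.chartTransform p ({0, 1} : Finset (Fin 4)) 0 s.F)) = _
  rw [hs, chartTransform_S0_bcert, PointBlowup.translate_zero]
  exact Literature.Barriers.ResolutionOfSingularities.HauserPerlega.deletePthPowers_eq_self (isClean_F0_bcert hp.out.two_le)

omit [CharP K p] in
/-- **The child's extra reading state is `F₁`.** [cite: HauserPerlega2019PRIMS, §2 (cleaning)] -/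
theorem escState_S1_bcert [DecidableEq K] (s : State K)
    (hs : s.F = X 0 ^ (3 * p) * X 3 + X 0 ^ (p - 1) * X 1 * X 2 ^ (2 * p) + X 0 * X 1 ^ p * X 2 ^ (p - 1) + X 1 ^ (2 * p + 1)) :
    (escState p ({0, 1} : Finset (Fin 4)) 1 (0 : Fin 4 → K) s).F =
      C 1 * (X 0 ^ (3 * p) * X 1 ^ (2 * p) * X 2 ^ 0 * X 3 ^ 1) +
        C 1 * (X 0 ^ (p - 1) * X 1 ^ 0 * X 2 ^ (2 * p) * X 3 ^ 0) +
        C 1 * (X 0 ^ 1 * X 1 ^ 1 * X 2 ^ (p - 1) * X 3 ^ 0) +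
        C 1 * (X 0 ^ 0 * X 1 ^ (p + 1) * X 2 ^ 0 * X 3 ^ 0) := by
  show deletePthPowers p (PointBlowup.translate (0 : Fin 4 → K)
    (CentreBlowup.chartTransform p ({0, 1} : Finset (Fin 4)) 1 s.F)) = _
  rw [hs, chartTransform_S1_bcert, PointBlowup.translate_zero]
  exact Literature.Barriers.ResolutionOfSingularities.HauserPerlega.deletePthPowers_eq_self (isClean_F1_bcert hp.out.two_le)

/-! ## §2 The child's charts -/

omit [CharP K p] in
/-- **The grandchild's entry point is equimultiple**: every monomial of `F₀₀` has degree `≥ p`. [cite: Hauser2010, §F] -/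
theorem isEquimultiplePoint_T0_zero_bcert [DecidableEq K] (s : State K)
    (hs : s.F = C 1 * (X 0 ^ (2 * p) * X 1 ^ 0 * X 2 ^ 0 * X 3 ^ 1) +
        C 1 * (X 0 ^ 0 * X 1 ^ 1 * X 2 ^ (2 * p) * X 3 ^ 0) +
        C 1 * (X 0 ^ 1 * X 1 ^ p * X 2 ^ (p - 1) * X 3 ^ 0) +
        C 1 * (X 0 ^ (p + 1) * X 1 ^ (2 * p + 1) * X 2 ^ 0 * X 3 ^ 0)) :
    CentreBlowup.IsEquimultiplePoint p ({0, 2} : Finset (Fin 4)) 0 (0 : Fin 4 → K) s := by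
  have hp1 : 1 ≤ p := hp.out.one_lt.le
  intro d hd0 hdeg
  unfold CentreBlowup.pointTransform
  rw [hs, chartTransform_T0_bcert, PointBlowup.translate_zero]
  by_contra hne
  rcases mem_support_four (mem_support_iff.mpr hne) with rfl | rfl | rfl | rfl <;>
    rw [Rescue.BedSlopeResidual.degree_E4] at hdeg <;> omega

omit [CharP K p] in
/-- **Chart `y₁` of the child's blow-up: the normalised equimultiple pairs lie on the grandchild** (`b₁ = 0 ⇒ b₂ = 0`; the coefficient
of `y₃^{p−1}` is `b₂^p`). [cite: Hauser2010, §F (equiconstant points)] -/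
theorem eq_zero_of_isEquimultiplePoint_T0_bcert [DecidableEq K] (hp3 : 3 ≤ p) {b : Fin 4 → K} (s : State K)
    (hs : s.F = C 1 * (X 0 ^ (2 * p) * X 1 ^ 0 * X 2 ^ 0 * X 3 ^ 1) +
        C 1 * (X 0 ^ 0 * X 1 ^ 1 * X 2 ^ (2 * p) * X 3 ^ 0) +
        C 1 * (X 0 ^ 1 * X 1 ^ p * X 2 ^ (p - 1) * X 3 ^ 0) +
        C 1 * (X 0 ^ (p + 1) * X 1 ^ (2 * p + 1) * X 2 ^ 0 * X 3 ^ 0))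
    (h : CentreBlowup.IsEquimultiplePoint p ({0, 2} : Finset (Fin 4)) 0 b s) (hb : b 0 = 0) : b 1 = 0 := by
  have hp0 : p ≠ 0 := hp.out.ne_zero
  unfold CentreBlowup.IsEquimultiplePoint CentreBlowup.pointTransform at h
  rw [hs, chartTransform_T0_bcert] at h
  have hc := h (Finsupp.single 0 0 + Finsupp.single 1 0 + Finsupp.single 2 (p - 1) + Finsupp.single 3 0)
    (fun he => by have := DFunLike.congr_fun he 2; simp at this; omega) (by rw [Rescue.BedSlopeResidual.degree_E4]; omega)
  rw [Rescue.BedMohRiseQ4TopLocus.translate_add, Rescue.BedMohRiseQ4TopLocus.translate_add, Rescue.BedMohRiseQ4TopLocus.translate_add,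
    coeff_add, coeff_add, coeff_add, coeff_translate_four, coeff_translate_four, coeff_translate_four, coeff_translate_four, hb,
    Nat.choose_eq_zero_of_lt (show 0 < p - 1 by omega)] at hc
  simp [zero_pow hp0] at hc
  exact hc.1

/-- **Chart `y₃` of the child's blow-up: the normalised OWNED equimultiple pairs lie on the grandchild** (`b₁ = 0 ⇒ b₂ = 0`;
`∂₁ F₀₂ (b) = b₂^p`). [cite: Hauser2010, §F (equiconstant points)] -/
theorem eq_zero_of_isEquimultiplePoint_T2_bcert [DecidableEq K] {b : Fin 4 → K} (s : State K)
    (hs : s.F = C 1 * (X 0 ^ (2 * p) * X 1 ^ 0 * X 2 ^ 0 * X 3 ^ 1) +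
        C 1 * (X 0 ^ 0 * X 1 ^ 1 * X 2 ^ (2 * p) * X 3 ^ 0) +
        C 1 * (X 0 ^ 1 * X 1 ^ p * X 2 ^ (p - 1) * X 3 ^ 0) +
        C 1 * (X 0 ^ (p + 1) * X 1 ^ (2 * p + 1) * X 2 ^ 0 * X 3 ^ 0))
    (h : CentreBlowup.IsEquimultiplePoint p ({0, 2} : Finset (Fin 4)) 2 b s) (hb0 : b 0 = 0) : b 1 = 0 := by
  have hp0 : p ≠ 0 := hp.out.ne_zero
  unfold CentreBlowup.IsEquimultiplePoint CentreBlowup.pointTransform at h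
  rw [hs, chartTransform_T2_bcert] at h
  have h0 := eval_pderiv_eq_zero_of_forall_coeff b _ h 0
  simp [(pderiv (0 : Fin 4)).leibniz_pow, hb0, hp0] at h0
  exact h0

omit [CharP K p] in
/-- **The grandchild's main reading state is `F₀₀`.** [cite: HauserPerlega2019PRIMS, §2 (cleaning)] -/
theorem step_T0_bcert [DecidableEq K] (s : State K)
    (hs : s.F = C 1 * (X 0 ^ (2 * p) * X 1 ^ 0 * X 2 ^ 0 * X 3 ^ 1) +
        C 1 * (X 0 ^ 0 * X 1 ^ 1 * X 2 ^ (2 * p) * X 3 ^ 0) +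
        C 1 * (X 0 ^ 1 * X 1 ^ p * X 2 ^ (p - 1) * X 3 ^ 0) +
        C 1 * (X 0 ^ (p + 1) * X 1 ^ (2 * p + 1) * X 2 ^ 0 * X 3 ^ 0)) :
    (CentreBlowup.step p ({0, 2} : Finset (Fin 4)) 0 (0 : Fin 4 → K) s).F =
      C 1 * (X 0 ^ p * X 1 ^ 0 * X 2 ^ 0 * X 3 ^ 1) +
        C 1 * (X 0 ^ p * X 1 ^ 1 * X 2 ^ (2 * p) * X 3 ^ 0) +
        C 1 * (X 0 ^ 0 * X 1 ^ p * X 2 ^ (p - 1) * X 3 ^ 0) +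
        C 1 * (X 0 ^ 1 * X 1 ^ (2 * p + 1) * X 2 ^ 0 * X 3 ^ 0) := by
  show deletePthPowers p (PointBlowup.translate (0 : Fin 4 → K)
    (CentreBlowup.chartTransform p ({0, 2} : Finset (Fin 4)) 0 s.F)) = _
  rw [hs, chartTransform_T0_bcert, PointBlowup.translate_zero]
  exact Literature.Barriers.ResolutionOfSingularities.HauserPerlega.deletePthPowers_eq_self (isClean_F00_bcert hp.out.two_le)

omit [CharP K p] in
/-- **The grandchild's extra reading state is `F₀₂`.** [cite: HauserPerlega2019PRIMS, §2 (cleaning)] -/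
theorem escState_T2_bcert [DecidableEq K] (s : State K)
    (hs : s.F = C 1 * (X 0 ^ (2 * p) * X 1 ^ 0 * X 2 ^ 0 * X 3 ^ 1) +
        C 1 * (X 0 ^ 0 * X 1 ^ 1 * X 2 ^ (2 * p) * X 3 ^ 0) +
        C 1 * (X 0 ^ 1 * X 1 ^ p * X 2 ^ (p - 1) * X 3 ^ 0) +
        C 1 * (X 0 ^ (p + 1) * X 1 ^ (2 * p + 1) * X 2 ^ 0 * X 3 ^ 0)) :
    (escState p ({0, 2} : Finset (Fin 4)) 2 (0 : Fin 4 → K) s).F =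
      C 1 * (X 0 ^ (2 * p) * X 1 ^ 0 * X 2 ^ p * X 3 ^ 1) +
        C 1 * (X 0 ^ 0 * X 1 ^ 1 * X 2 ^ p * X 3 ^ 0) +
        C 1 * (X 0 ^ 1 * X 1 ^ p * X 2 ^ 0 * X 3 ^ 0) +
        C 1 * (X 0 ^ (p + 1) * X 1 ^ (2 * p + 1) * X 2 ^ 1 * X 3 ^ 0) := by
  show deletePthPowers p (PointBlowup.translate (0 : Fin 4 → K)
    (CentreBlowup.chartTransform p ({0, 2} : Finset (Fin 4)) 2 s.F)) = _
  rw [hs, chartTransform_T2_bcert, PointBlowup.translate_zero]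
  exact Literature.Barriers.ResolutionOfSingularities.HauserPerlega.deletePthPowers_eq_self (isClean_F02_bcert hp.out.two_le)

/-- **Chart `y₂` of the child's blow-up on the extra reading is DEAD**: `∂₂ F₁₁ = 1`. [cite: Hauser2010, §F] -/
theorem not_isEquimultiplePoint_R1_bcert [DecidableEq K] {b : Fin 4 → K} (s : State K)
    (hs : s.F = C 1 * (X 0 ^ (3 * p) * X 1 ^ (2 * p) * X 2 ^ 0 * X 3 ^ 1) +
        C 1 * (X 0 ^ (p - 1) * X 1 ^ 0 * X 2 ^ (2 * p) * X 3 ^ 0) +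
        C 1 * (X 0 ^ 1 * X 1 ^ 1 * X 2 ^ (p - 1) * X 3 ^ 0) +
        C 1 * (X 0 ^ 0 * X 1 ^ (p + 1) * X 2 ^ 0 * X 3 ^ 0)) :
    ¬ CentreBlowup.IsEquimultiplePoint p ({1, 2} : Finset (Fin 4)) 1 b s := by
  intro h
  unfold CentreBlowup.IsEquimultiplePoint CentreBlowup.pointTransform at h
  rw [hs, chartTransform_R1_bcert] at h
  have h1 := eval_pderiv_eq_zero_of_forall_coeff b _ h 1
  simp [(pderiv (1 : Fin 4)).leibniz_pow] at h1

omit [CharP K p] in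
/-- **Chart `y₃` of the child's blow-up on the extra reading is DEAD**: the coefficient of `y₁ y₂` is `1` (`p ≥ 3`).
[cite: Hauser2010, §F (equiconstant points)] -/
theorem not_isEquimultiplePoint_R2_bcert [DecidableEq K] (hp3 : 3 ≤ p) {b : Fin 4 → K} (s : State K)
    (hs : s.F = C 1 * (X 0 ^ (3 * p) * X 1 ^ (2 * p) * X 2 ^ 0 * X 3 ^ 1) +
        C 1 * (X 0 ^ (p - 1) * X 1 ^ 0 * X 2 ^ (2 * p) * X 3 ^ 0) +
        C 1 * (X 0 ^ 1 * X 1 ^ 1 * X 2 ^ (p - 1) * X 3 ^ 0) +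
        C 1 * (X 0 ^ 0 * X 1 ^ (p + 1) * X 2 ^ 0 * X 3 ^ 0))
    (hb2 : b 2 = 0) : ¬ CentreBlowup.IsEquimultiplePoint p ({1, 2} : Finset (Fin 4)) 2 b s := by
  have hp0 : p ≠ 0 := hp.out.ne_zero
  intro h
  unfold CentreBlowup.IsEquimultiplePoint CentreBlowup.pointTransform at h
  rw [hs, chartTransform_R2_bcert] at h
  have hc := h (Finsupp.single 0 1 + Finsupp.single 1 1 + Finsupp.single 2 0 + Finsupp.single 3 0)
    (fun he => by have := DFunLike.congr_fun he 0; simp at this) (by rw [Rescue.BedSlopeResidual.degree_E4]; omega)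
  rw [Rescue.BedMohRiseQ4TopLocus.translate_add, Rescue.BedMohRiseQ4TopLocus.translate_add, Rescue.BedMohRiseQ4TopLocus.translate_add,
    coeff_add, coeff_add, coeff_add, coeff_translate_four, coeff_translate_four, coeff_translate_four, coeff_translate_four, hb2,
    Nat.choose_eq_zero_of_lt (show 0 < 1 by omega)] at hc
  simp [zero_pow hp0] at hc

/-! ## §3 The grandchild's blow-up is dead -/

omit [CharP K p] in
/-- **Chart `y₁` of the grandchild's blow-up is DEAD**: `∂₄ F₀₀₀ = 1`. [cite: Hauser2010, §F (equiconstant points)] -/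
theorem not_isEquimultiplePoint_U0_bcert [DecidableEq K] {b : Fin 4 → K} (s : State K)
    (hs : s.F = C 1 * (X 0 ^ p * X 1 ^ 0 * X 2 ^ 0 * X 3 ^ 1) +
        C 1 * (X 0 ^ p * X 1 ^ 1 * X 2 ^ (2 * p) * X 3 ^ 0) +
        C 1 * (X 0 ^ 0 * X 1 ^ p * X 2 ^ (p - 1) * X 3 ^ 0) +
        C 1 * (X 0 ^ 1 * X 1 ^ (2 * p + 1) * X 2 ^ 0 * X 3 ^ 0)) :
    ¬ CentreBlowup.IsEquimultiplePoint p ({0, 1} : Finset (Fin 4)) 0 b s := by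
  intro h
  unfold CentreBlowup.IsEquimultiplePoint CentreBlowup.pointTransform at h
  rw [hs, chartTransform_U0_bcert] at h
  have h3 := eval_pderiv_eq_zero_of_forall_coeff b _ h 3
  simp [(pderiv (3 : Fin 4)).leibniz_pow] at h3

omit hp [CharP K p] in
/-- **Chart `y₂` of the grandchild's blow-up is DEAD**: the coefficient of `y₃^{p−1}` is `1`. [cite: Hauser2010, §F] -/
theorem not_isEquimultiplePoint_U1_bcert [DecidableEq K] (hp3 : 3 ≤ p) {b : Fin 4 → K} (s : State K)
    (hs : s.F = C 1 * (X 0 ^ p * X 1 ^ 0 * X 2 ^ 0 * X 3 ^ 1) +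
        C 1 * (X 0 ^ p * X 1 ^ 1 * X 2 ^ (2 * p) * X 3 ^ 0) +
        C 1 * (X 0 ^ 0 * X 1 ^ p * X 2 ^ (p - 1) * X 3 ^ 0) +
        C 1 * (X 0 ^ 1 * X 1 ^ (2 * p + 1) * X 2 ^ 0 * X 3 ^ 0))
    (hb1 : b 1 = 0) : ¬ CentreBlowup.IsEquimultiplePoint p ({0, 1} : Finset (Fin 4)) 1 b s := by
  intro h
  unfold CentreBlowup.IsEquimultiplePoint CentreBlowup.pointTransform at h
  rw [hs, chartTransform_U1_bcert] at h
  have hc := h (Finsupp.single 0 0 + Finsupp.single 1 0 + Finsupp.single 2 (p - 1) + Finsupp.single 3 0)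
    (fun he => by have := DFunLike.congr_fun he 2; simp at this; omega) (by rw [Rescue.BedSlopeResidual.degree_E4]; omega)
  rw [Rescue.BedMohRiseQ4TopLocus.translate_add, Rescue.BedMohRiseQ4TopLocus.translate_add, Rescue.BedMohRiseQ4TopLocus.translate_add,
    coeff_add, coeff_add, coeff_add, coeff_translate_four, coeff_translate_four, coeff_translate_four, coeff_translate_four, hb1,
    Nat.choose_eq_zero_of_lt (show 0 < p - 1 by omega)] at hc
  simp at hc

/-- **Chart `y₂` of the grandchild's blow-up on its extra reading is DEAD**: `∂₁ F₀₂₁ (b) = 1` for `b₂ = 0`.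
[cite: Hauser2010, §F (equiconstant points)] -/
theorem not_isEquimultiplePoint_W1_bcert [DecidableEq K] {b : Fin 4 → K} (s : State K)
    (hs : s.F = C 1 * (X 0 ^ (2 * p) * X 1 ^ 0 * X 2 ^ p * X 3 ^ 1) +
        C 1 * (X 0 ^ 0 * X 1 ^ 1 * X 2 ^ p * X 3 ^ 0) +
        C 1 * (X 0 ^ 1 * X 1 ^ p * X 2 ^ 0 * X 3 ^ 0) +
        C 1 * (X 0 ^ (p + 1) * X 1 ^ (2 * p + 1) * X 2 ^ 1 * X 3 ^ 0))
    (hb1 : b 1 = 0) : ¬ CentreBlowup.IsEquimultiplePoint p ({1, 2} : Finset (Fin 4)) 1 b s := by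
  intro h
  unfold CentreBlowup.IsEquimultiplePoint CentreBlowup.pointTransform at h
  rw [hs, chartTransform_W1_bcert] at h
  have h0 := eval_pderiv_eq_zero_of_forall_coeff b _ h 0
  simp [(pderiv (0 : Fin 4)).leibniz_pow, hb1] at h0

omit hp [CharP K p] in
/-- **Chart `y₃` of the grandchild's blow-up on its extra reading is DEAD**: the coefficient of `y₂ y₃` is `1` for OWNED pairs
(`b₁ = 0`; `p ≥ 3`). [cite: Hauser2010, §F (equiconstant points)] -/
theorem not_isEquimultiplePoint_W2_bcert [DecidableEq K] (hp3 : 3 ≤ p) {b : Fin 4 → K} (s : State K)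
    (hs : s.F = C 1 * (X 0 ^ (2 * p) * X 1 ^ 0 * X 2 ^ p * X 3 ^ 1) +
        C 1 * (X 0 ^ 0 * X 1 ^ 1 * X 2 ^ p * X 3 ^ 0) +
        C 1 * (X 0 ^ 1 * X 1 ^ p * X 2 ^ 0 * X 3 ^ 0) +
        C 1 * (X 0 ^ (p + 1) * X 1 ^ (2 * p + 1) * X 2 ^ 1 * X 3 ^ 0))
    (hb0 : b 0 = 0) : ¬ CentreBlowup.IsEquimultiplePoint p ({1, 2} : Finset (Fin 4)) 2 b s := by
  intro h
  unfold CentreBlowup.IsEquimultiplePoint CentreBlowup.pointTransform at h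
  rw [hs, chartTransform_W2_bcert] at h
  have hc := h (Finsupp.single 0 0 + Finsupp.single 1 1 + Finsupp.single 2 1 + Finsupp.single 3 0)
    (fun he => by have := DFunLike.congr_fun he 1; simp at this) (by rw [Rescue.BedSlopeResidual.degree_E4]; omega)
  rw [Rescue.BedMohRiseQ4TopLocus.translate_add, Rescue.BedMohRiseQ4TopLocus.translate_add, Rescue.BedMohRiseQ4TopLocus.translate_add,
    coeff_add, coeff_add, coeff_add, coeff_translate_four, coeff_translate_four, coeff_translate_four, coeff_translate_four, hb0,
    Nat.choose_eq_zero_of_lt (show 0 < 1 by omega)] at hc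
  simp at hc

end BCertCharts

end Equimultiple

end Summit.ResolutionOfSingularities.ResolutionOfSingularities.Theorems.PIDim4

end
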